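import Summits.MatrixMultiplication.OmegaCensus.STPPCriticalPairsZ46APSum

/-!
# ω-census (abelian STPP census): small progressions inside progressions of `ℤ/46ℤ` — step relations (kernel tool)

HONEST FRAMING (pub-omega census; verbatim): lottery ticket; floor = certified bounds/negative ranges.
Census STRUCTURE (seat pub-omega-stpp-2 gen 32, 2026-08-30), family (b2); tools for the «all-progression» branch of the case map of
`{(2,2,3),(3,3,2),(3,3,2)} @ 46` (HOME `pub-omega-stpp-2-g32/CASEMAP.md`), where `Y_{i′} = C_{i′} − B_{i′}` (a `2 × 3` grid of steps `δ_{i′}, e_{i′}`) lies in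
the `12`-progression `Y°ᵢ` of step `dᵢ`, etc.  In `ℤ/46ℤ`, for a step `d` with `2d ≠ 0` (order `23` or `46`):
* `step_of_ap3_subset_12/_13` : `y, y + e, y + 2e ∈ {t, t + d, …, t + (n−1)d}` ⇒ `e = ±m•d` with `1 ≤ m ≤ 5` (`n = 12`), resp. `m ≤ 6` or `m = 11`
  (`n = 13`; `m = 11` only for `d` of order `23`: `{y − d, y, y + 11d}`);
* `step_of_pair_subset` : `y, y + δ ∈ {t, …, t + (n−1)d}`, `δ ≠ 0` ⇒ `δ = ±k•d` with `1 ≤ k ≤ n − 1`;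
* `eq_or_eq_neg_of_mutual_multiple` : `e = ±m•d` and `d = ±m′•e` with `m, m′ ≤ 5` ⇒ `m = m′ = 1` (so `e = ±d`); with `6` allowed the order-`23` steps
  have the exception `(m, m′) = (4, 6)` (`24 ≡ 1 mod 23`).
All by the index technique of `STPPCriticalPairsZ46APSum.lean` (kernel decisions over `d` and indices `< 13`).  For `12` terms the admissible multiples are the same for
steps of order `23` and `46`; for `13` terms the order-`23` steps add `±11` (and the mutual-multiple cancellation then has the exception `4 · 6 ≡ 1`).  Nothing
here is progress on `ω`.

References: M. B. Nathanson, GTM 165, §2.5 (tree: `apFinset`); H. Cohn, R. Kleinberg, B. Szegedy, C. Umans, FOCS 2005, Def. 5.1 (the use).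
-/

open Finset
open scoped Pointwise

namespace Summit.MatrixMultiplication.OmegaCensus.Z46

open Literature.Combinatorics.Additive

set_option synthInstance.maxHeartbeats 400000 in
set_option synthInstance.maxSize 4096 in
/-- Index form of `step_of_ap3_subset`, `12` terms (kernel decision): the middle step is `±m•d` with `1 ≤ m ≤ 5`. [folklore] -/
theorem index_ap3_12 : ∀ d : ZMod 46, 2 • d ≠ 0 → ∀ i < 12, ∀ j < 12, ∀ l < 12,
    (j • d - i • d : ZMod 46) + (j • d - i • d) = l • d - i • d → j ≠ i →
    ∃ m < 6, 1 ≤ m ∧ ((j • d - i • d : ZMod 46) = m • d ∨ (j • d - i • d : ZMod 46) = -(m • d)) := by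
  set_option maxRecDepth 100000 in decide +kernel

set_option synthInstance.maxHeartbeats 400000 in
set_option synthInstance.maxSize 4096 in
/-- Index form of `step_of_ap3_subset`, `13` terms (kernel decision): the middle step is `±m•d` with `1 ≤ m ≤ 6` or — only for steps of order `23` —
`m = 11` (`{y − d, y, y + 11d}` read with step `11d`, `22d = −d`). [folklore] -/
theorem index_ap3_13 : ∀ d : ZMod 46, 2 • d ≠ 0 → ∀ i < 13, ∀ j < 13, ∀ l < 13,
    (j • d - i • d : ZMod 46) + (j • d - i • d) = l • d - i • d → j ≠ i →
    ∃ m < 12, 1 ≤ m ∧ (m ≤ 6 ∨ m = 11) ∧ ((j • d - i • d : ZMod 46) = m • d ∨ (j • d - i • d : ZMod 46) = -(m • d)) := by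
  set_option maxRecDepth 100000 in decide +kernel

set_option synthInstance.maxHeartbeats 400000 in
set_option synthInstance.maxSize 4096 in
/-- Index form of `step_of_pair_subset` (kernel decision). [folklore] -/
theorem index_pair : ∀ d : ZMod 46, 2 • d ≠ 0 → ∀ n ≤ 13, ∀ i < n, ∀ j < n, j ≠ i →
    ∃ k < 13, 1 ≤ k ∧ k + 1 ≤ n ∧ ((j • d - i • d : ZMod 46) = k • d ∨ (j • d - i • d : ZMod 46) = -(k • d)) := by
  set_option maxRecDepth 100000 in decide +kernel

/-- **A `3`-term progression of step `e` inside a `12`-term progression of step `d` (`2d ≠ 0`) has `e = ±m•d` with `1 ≤ m ≤ 5`.** [folklore] -/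
theorem step_of_ap3_subset_12 {t d y e : ZMod 46} (hd : 2 • d ≠ 0) (he : e ≠ 0)
    (h0 : y ∈ apFinset t d 12) (h1 : y + e ∈ apFinset t d 12) (h2 : y + e + e ∈ apFinset t d 12) :
    ∃ m : ℕ, 1 ≤ m ∧ m ≤ 5 ∧ (e = m • d ∨ e = -(m • d)) := by
  rw [mem_apFinset] at h0 h1 h2
  obtain ⟨i, hi, hyi⟩ := h0
  obtain ⟨j, hj, hyj⟩ := h1
  obtain ⟨l, hl, hyl⟩ := h2
  have he1 : e = j • d - i • d := by
    have : (t + j • d) - (t + i • d) = e := by rw [hyi, hyj]; abel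
    rw [← this]; abel
  have he2 : e + e = l • d - i • d := by
    have : (t + l • d) - (t + i • d) = e + e := by rw [hyi, hyl]; abel
    rw [← this]; abel
  have hji : j ≠ i := by rintro rfl; exact he (by rw [he1, sub_self])
  obtain ⟨m, hm6, hm1, hm⟩ := index_ap3_12 d hd i hi j hj l hl (by rw [← he1, he2]) hji
  exact ⟨m, hm1, by omega, by rw [he1]; exact hm⟩

/-- **A `3`-term progression of step `e` inside a `13`-term progression of step `d` (`2d ≠ 0`) has `e = ±m•d` with `1 ≤ m ≤ 6` or `m = 11`** (the latter only
for `d` of order `23`). [folklore] -/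
theorem step_of_ap3_subset_13 {t d y e : ZMod 46} (hd : 2 • d ≠ 0) (he : e ≠ 0)
    (h0 : y ∈ apFinset t d 13) (h1 : y + e ∈ apFinset t d 13) (h2 : y + e + e ∈ apFinset t d 13) :
    ∃ m : ℕ, 1 ≤ m ∧ (m ≤ 6 ∨ m = 11) ∧ (e = m • d ∨ e = -(m • d)) := by
  rw [mem_apFinset] at h0 h1 h2
  obtain ⟨i, hi, hyi⟩ := h0
  obtain ⟨j, hj, hyj⟩ := h1
  obtain ⟨l, hl, hyl⟩ := h2
  have he1 : e = j • d - i • d := by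
    have : (t + j • d) - (t + i • d) = e := by rw [hyi, hyj]; abel
    rw [← this]; abel
  have he2 : e + e = l • d - i • d := by
    have : (t + l • d) - (t + i • d) = e + e := by rw [hyi, hyl]; abel
    rw [← this]; abel
  have hji : j ≠ i := by rintro rfl; exact he (by rw [he1, sub_self])
  obtain ⟨m, -, hm1, hm6, hm⟩ := index_ap3_13 d hd i hi j hj l hl (by rw [← he1, he2]) hji
  exact ⟨m, hm1, hm6, by rw [he1]; exact hm⟩

/-- **Two elements `y, y + δ` (`δ ≠ 0`) of an `n`-term progression of step `d` (`n ≤ 13`, `2d ≠ 0`) have `δ = ±k•d` with `1 ≤ k ≤ n − 1`.** [folklore] -/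
theorem step_of_pair_subset {t d y δ : ZMod 46} {n : ℕ} (hd : 2 • d ≠ 0) (hn : n ≤ 13) (hδ : δ ≠ 0)
    (h0 : y ∈ apFinset t d n) (h1 : y + δ ∈ apFinset t d n) :
    ∃ k : ℕ, 1 ≤ k ∧ k + 1 ≤ n ∧ (δ = k • d ∨ δ = -(k • d)) := by
  rw [mem_apFinset] at h0 h1
  obtain ⟨i, hi, hyi⟩ := h0
  obtain ⟨j, hj, hyj⟩ := h1
  have he1 : δ = j • d - i • d := by
    have : (t + j • d) - (t + i • d) = δ := by rw [hyi, hyj]; abel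
    rw [← this]; abel
  have hji : j ≠ i := by rintro rfl; exact hδ (by rw [he1, sub_self])
  obtain ⟨k, -, hk1, hkn, hk⟩ := index_pair d hd n hn i hi j hj hji
  exact ⟨k, hk1, hkn, by rw [he1]; exact hk⟩

set_option synthInstance.maxHeartbeats 400000 in
set_option synthInstance.maxSize 4096 in
/-- Cancellation (kernel decision): if `e = ±m•d` and `d = ±m′•e` with `1 ≤ m, m′ ≤ 5` and `2d ≠ 0`, then `m = m′ = 1`.  (With `6` allowed this FAILS for steps
of order `23`: `e = 4d`, `d = 6e` since `24 ≡ 1 (mod 23)` — the `13`-term containments need that case treated separately.) [folklore] -/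
theorem index_mutual : ∀ d : ZMod 46, 2 • d ≠ 0 → ∀ m < 6, ∀ m' < 6, m ≠ 0 → m' ≠ 0 →
    ∀ e : ZMod 46, (e = (m • d : ZMod 46) ∨ e = -(m • d : ZMod 46)) → (d = (m' • e : ZMod 46) ∨ d = -(m' • e : ZMod 46)) → m = 1 ∧ m' = 1 := by
  set_option maxRecDepth 100000 in decide +kernel

/-- **Mutual small multiples are `±1`:** `e = ±m•d`, `d = ±m′•e`, `1 ≤ m, m′ ≤ 5`, `2d ≠ 0` ⇒ `e = d ∨ e = −d`. [folklore] -/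
theorem eq_or_eq_neg_of_mutual_multiple {d e : ZMod 46} (hd : 2 • d ≠ 0) {m m' : ℕ} (hm : 1 ≤ m) (hm6 : m ≤ 5) (hm' : 1 ≤ m') (hm'6 : m' ≤ 5)
    (h1 : e = m • d ∨ e = -(m • d)) (h2 : d = m' • e ∨ d = -(m' • e)) : e = d ∨ e = -d := by
  obtain ⟨rfl, -⟩ := index_mutual d hd m (by omega) m' (by omega) (by omega) (by omega) e h1 h2
  simpa using h1

end Summit.MatrixMultiplication.OmegaCensus.Z46
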